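import Summits.Ventures.HSemireg.PerfectComplexRankDoor
import Summits.Ventures.HSemireg.ExtRankOfSchemeIso
import HarnessLib

/-!
# Venture HSemireg — the RANK admissibility notion `rankAdmissible C` transports along an isomorphism of the base `ℂ`-scheme

research route conditional on HC_CM; not a corollary; Q11.4-sentence-2 already refuted in dim ≥ 3.

HONEST FRAMING. Kernel bookkeeping completing the record of `ExtRankOfSchemeIso.lean` (ring2-b06 gen 118: «the `Ext`-side of ALL the
venture's admissibility notions transports along `e^*`; what remains for `rankAdmissible` is the contraction-rank clause»). Nothing about
any explicit variety; nothing here says HC, HC_CM or HC_AV is proved; no Literature fact. Seat ring2-b06 gen 119 (idle-time item after the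
banked support target `HomComplex.IsISemiregularC.of_schemeIso` was closed, `HomComplexSigmaOfSchemeIso.lean`). With this file all three
admissibility notions of the venture transport along pull-back by isomorphisms `e : Y' ≅ Y` of `ℂ`-schemes: `gluableSigmaAdmissible`
(`gluableSigmaAdmissible_pullback_of_schemeIso`), `sigmaAdmissible` (`Theorems/VHCAbelianSchemesRoadTwistedDoorIsoRespects`), and here
**`rankAdmissible_pullback_of_schemeIso`** — `rankAdmissible C n Y I E → rankAdmissible C n Y' I (e^*E)` for `E` a bounded complex of vector
bundles: clause (i) is unchanged; the `Ext`-rank clauses by `extRank_pullback_eq`; the contraction-rank clause because the Chern character of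
`e^*E` transported to the abelian variety `A` by `A.X ≅ Y ≅ Y'` IS the Chern character of `E` transported by `A.X ≅ Y`
(`map_chPerfect_trans_symm`: `ch(e^*E) = e^*ch(E)`, p4's `map_chPerfect`, and `(e⁻¹)^* e^* = id`).

References: [BuchweitzFlenner2008HH] Prop. 6.4.4 (the contraction rank); [Fulton1998] §15.1 (ii) (`ch ∘ f^* = f^* ∘ ch`); [Lieblich2006]
Prop. 2.1.9; [Orlov2002DerivedAbelian] p. 3 (exact equivalences preserve `Ext`). Bookkeeping along an isomorphism (reading).
-/

noncomputable section

open CategoryTheory CategoryTheory.Limits AlgebraicGeometry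
open AlgebraicGeometry.Scheme.Modules
open Literature.AlgebraicGeometry.Motives Literature.AlgebraicGeometry.HodgeTheory Literature.AlgebraicGeometry.KTheory
open Literature.AlgebraicTopology.SingularHomology

namespace Summit.Ventures.HSemireg

variable (C : ChernCharacterBetti) {Y Y' : SchemeOver ℂ} (e : Y' ≅ Y)

/-- `(e⁻¹)^* (e^* x) = x` on `H•(–(ℂ); ℂ)` for an isomorphism `e : Y' ≅ Y`. [folklore] -/
theorem complexBetti_map_inv_map_hom (i : ℕ) (x : complexBetti Y i) :
    complexBetti.map e.inv i (complexBetti.map e.hom i x) = x := by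
  rw [← ModuleCat.comp_apply, ← complexBetti.map_comp, Iso.inv_hom_id, complexBetti.map_id]
  rfl

/-- **The Chern character of `e^*E` transported to `A` along `A.X ≅ Y ≅ Y'` is the Chern character of `E` transported along `A.X ≅ Y`**:
`(e_A ≫ e⁻¹)^* ch_p(e^*E) = e_A^* ch_p(E)` (`ch_p(e^*E) = e^* ch_p(E)`, `map_chPerfect`). [cite: Fulton1998, §15.1 (ii)] -/
theorem map_chPerfect_trans_symm {E : CochainComplex Y.left.Modules ℤ} (hE : IsBoundedVBComplex E) {Z : SchemeOver ℂ} (eA : Z ≅ Y)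
    (p : ℕ) :
    complexBetti.map (eA ≪≫ e.symm).hom (2 * p)
        (chPerfect C Y' (((Scheme.Modules.pullback e.hom.left).mapHomologicalComplex _).obj E)
          (hE.pullback e.hom.left).isFiniteLocallyFree p) =
      complexBetti.map eA.hom (2 * p) (chPerfect C Y E hE.isFiniteLocallyFree p) := by
  rw [← map_chPerfect C Y e.hom hE p, Iso.trans_hom, Iso.symm_hom, complexBetti.map_comp, ModuleCat.comp_apply,
    complexBetti_map_inv_map_hom]

/-- **`rankAdmissible C` transports along pull-back by an isomorphism of `ℂ`-schemes** on bounded complexes of vector bundles: `{1..n} ⊆ I`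
unchanged; `Ext^{<0} = 0`, `Hom = ℂ` and `rank Ext²` by `extRank_pullback_eq`; the abelian model `A.X ≅ Y` becomes `A.X ≅ Y ≅ Y'` and the
contraction rank of the transported Chern character is the same (`map_chPerfect_trans_symm`). [cite: BuchweitzFlenner2008HH, Prop. 6.4.4]
[cite: Fulton1998, §15.1 (ii)] [cite: Lieblich2006, Prop. 2.1.9] -/
theorem rankAdmissible_pullback_of_schemeIso :
    ∀ (n : ℕ) ⦃Y Y' : SchemeOver ℂ⦄ (e : Y' ≅ Y) (I : Finset ℕ) (E : CochainComplex Y.left.Modules ℤ),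
      IsBoundedVBComplex E → rankAdmissible C n Y I E →
        rankAdmissible C n Y' I (((Scheme.Modules.pullback e.hom.left).mapHomologicalComplex _).obj E) := by
  intro n Y Y' e I E _ h
  obtain ⟨hI, hneg, h0, A, eA, hE, hdim, hle⟩ := h
  refine ⟨hI, fun k hk => ?_, ?_, A, eA ≪≫ e.symm, hE.pullback e.hom.left, hdim, ?_⟩
  · rw [extRank_pullback_eq]
    exact hneg k hk
  · rw [extRank_pullback_eq]
    exact h0
  · have hκ : (fun p => complexBetti.map (eA ≪≫ e.symm).hom (2 * p)
        (chPerfect C Y' (((Scheme.Modules.pullback e.hom.left).mapHomologicalComplex _).obj E)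
          (hE.pullback e.hom.left).isFiniteLocallyFree p)) =
        fun p => complexBetti.map eA.hom (2 * p) (chPerfect C Y E hE.isFiniteLocallyFree p) :=
      funext fun p => map_chPerfect_trans_symm C e hE eA p
    rw [extRank_pullback_eq, hκ]
    exact hle

end Summit.Ventures.HSemireg

end
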